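import Mathlib
import HarnessLib
import Summits.AtomisticToContinuum.BoseEinsteinCondensation.Theses.BECStronglyRayleigh
import Literature.Combinatorics.StablePolynomials.KernelForm
import Literature.MathematicalPhysics.QuantumLattice.HeisenbergModel
import Literature.MathematicalPhysics.QuantumLattice.LiebMattisSectorPF

/-!
# Sketch — ideator 2 (round 1): the Brauer positive cone of the XXZ bond

Crux `BECStronglyRayleigh.GroundStateStability` (stmt-AtomisticToContinuum-9672).

Card `brauer-positive-cone`.  With `T_b := 2 𝐒_x·𝐒_y + ½` (Dirac's exchange = the SWAP of the two
spins) and `Q_b := 2(S¹_xS¹_y + S²_xS²_y − S³_xS³_y) + ½ = 2 |↑↓+↓↑⟩⟨↑↓+↓↑|` (the Brauer contraction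
of `O(2)` written in the weight basis), the crux's bond operator is

  `S¹_xS¹_y + S²_xS²_y + Δ S³_xS³_y = ((1+Δ)/4) T_b + ((1−Δ)/4) Q_b − ¼`,

a NONNEGATIVE combination of `T_b, Q_b` exactly when `|Δ| ≤ 1`.  `T_b, Q_b` commute, `T_b² = 1`,
`T_b Q_b = Q_b T_b = Q_b`, `Q_b² = 2 Q_b`, so the bond Gibbs factor is, in closed form,

  `exp(t(S¹S¹+S²S²+ΔS³S³)_b) = e^{-t/4} ( cosh(αt)·1 + sinh(αt)·T_b + e^{αt}(e^{2βt}−1)/2 · Q_b )`,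
  `α = (1+Δ)/4`, `β = (1−Δ)/4`,

an element of the closed convex cone `C_b = cone{1, T_b, Q_b}` for every `t ≥ 0` iff `|Δ| ≤ 1`; so is
the Euler gate `1 + ε(…)_b = (1−ε/4)·1 + εα T_b + εβ Q_b` (`0 ≤ ε ≤ 4`).  The Borcea–Brändén symbols of
`1, T_b, Q_b` on the bond are the three PERFECT MATCHINGS of `K₄` on `{z_x, z_y, w_x, w_y}`:
`(z_x+w_x)(z_y+w_y)`, `(z_x+w_y)(z_y+w_x)`, `(z_x+z_y)(w_x+w_y)`; and every nonnegative nontrivial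
combination of them is zero-free on `H⁴` by the SERIES–PARALLEL identity
`Im((P+Q)(R+S)·conj(P+Q+R+S)) = |P+Q|² Im(R+S) + |R+S|² Im(P+Q) > 0` (proved below,
`seriesParallel_im`, `k4Matchings_ne_zero`).  With the PROVED kernel form of BB Lemma 2.2
(`multiAffine_kernel_stable_or_zero`) this makes every element of `C_b` a stability preserver
(`BrauerConePreserves`, the card's first lemma), which contains stubs A and B(i) of the picked line
`stable-cone-variational-selection` as special cases (`ConeGivesGateAndBondSemigroup`).

Proved here (no sorry): `seriesParallel_im`, `seriesParallel_im_pos`, `k4Matchings_ne_zero`, and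
`gate_apply_eq_cone` (the Euler gate `1 + ε(…)_b` IS the cone action with coordinates
`(1−ε/4, ε(1+Δ)/4, ε(1−Δ)/4)`, pointwise on occupation amplitudes, from the disprover's
`xxzBond_mulVec_apply`, reproduced verbatim in §4b).
Stated as `def … : Prop` (to be proved by the line): `BrauerBondAlgebra`, `BondInBrauerCone`,
`BondExpClosedForm`, `K4SymbolOfCone`, `BrauerConePreserves`, `ConeGivesGateAndBondSemigroup`,
`SectorInterlacing` (a corollary/falsifier, not used by the line).
-/

namespace Summit.AtomisticToContinuum.BoseEinsteinCondensation.Cruxes.GroundStateStability.SketchK2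

open Literature.MathematicalPhysics.QuantumLattice Literature.Combinatorics.StablePolynomials
open scoped BigOperators ComplexConjugate Matrix ComplexOrder

noncomputable section

/-! ### 1. The series–parallel lemma (proved) -/

/-- `Im( u·v·conj(u+v) ) = |u|²·Im v + |v|²·Im u`: a product of two "impedances" read against their
series sum.  Equivalently `(u·v)/(u+v)`, the parallel sum, has positive imaginary part when `u, v` do. -/
theorem seriesParallel_im (u v : ℂ) :
    (u * v * conj (u + v)).im = (u.re ^ 2 + u.im ^ 2) * v.im + (v.re ^ 2 + v.im ^ 2) * u.im := by
  simp only [Complex.mul_im, Complex.mul_re, map_add, Complex.add_re, Complex.add_im,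
    Complex.conj_re, Complex.conj_im]
  ring

theorem seriesParallel_im_pos {u v : ℂ} (hu : 0 < u.im) (hv : 0 < v.im) :
    0 < (u * v * conj (u + v)).im := by
  rw [seriesParallel_im]
  have h1 : 0 < u.re ^ 2 + u.im ^ 2 := by positivity
  have h2 : 0 < v.re ^ 2 + v.im ^ 2 := by positivity
  positivity

/-- **K₄ matching lemma.**  For `P Q R S` in the open upper half-plane and nonnegative weights, not
all zero, the weighted sum of the three perfect-matching products of `K₄`,
`c₁(P+R)(Q+S) + c₂(P+S)(Q+R) + c₃(P+Q)(R+S)`, is nonzero.  (These are the bond symbols of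
`1`, `T_b`, `Q_b` at `(P,Q,R,S) = (z_x,z_y,w_x,w_y)`.)  Proof: multiply by `conj(P+Q+R+S)` and take
imaginary parts — each matching contributes a positive amount by `seriesParallel_im_pos`. -/
theorem k4Matchings_ne_zero {P Q R S : ℂ} (hP : 0 < P.im) (hQ : 0 < Q.im) (hR : 0 < R.im)
    (hS : 0 < S.im) {c₁ c₂ c₃ : ℝ} (h₁ : 0 ≤ c₁) (h₂ : 0 ≤ c₂) (h₃ : 0 ≤ c₃)
    (hsum : 0 < c₁ + c₂ + c₃) :
    (c₁ : ℂ) * ((P + R) * (Q + S)) + (c₂ : ℂ) * ((P + S) * (Q + R)) + (c₃ : ℂ) * ((P + Q) * (R + S)) ≠ 0 := by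
  set Tot : ℂ := P + Q + R + S with hTot
  have e₁ : (P + R) + (Q + S) = Tot := by rw [hTot]; ring
  have e₂ : (P + S) + (Q + R) = Tot := by rw [hTot]; ring
  have e₃ : (P + Q) + (R + S) = Tot := by rw [hTot]; ring
  have x₁ : 0 < ((P + R) * (Q + S) * conj Tot).im := by
    rw [← e₁]; exact seriesParallel_im_pos (by simp; linarith) (by simp; linarith)
  have x₂ : 0 < ((P + S) * (Q + R) * conj Tot).im := by
    rw [← e₂]; exact seriesParallel_im_pos (by simp; linarith) (by simp; linarith)
  have x₃ : 0 < ((P + Q) * (R + S) * conj Tot).im := by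
    rw [← e₃]; exact seriesParallel_im_pos (by simp; linarith) (by simp; linarith)
  intro hzero
  have hmul : ((c₁ : ℂ) * ((P + R) * (Q + S)) + (c₂ : ℂ) * ((P + S) * (Q + R)) +
      (c₃ : ℂ) * ((P + Q) * (R + S))) * conj Tot = 0 := by rw [hzero, zero_mul]
  have him : c₁ * ((P + R) * (Q + S) * conj Tot).im + c₂ * ((P + S) * (Q + R) * conj Tot).im +
      c₃ * ((P + Q) * (R + S) * conj Tot).im = 0 := by
    have := congrArg Complex.im hmul
    simpa [add_mul, mul_assoc, Complex.add_im, Complex.re_ofReal_mul, Complex.im_ofReal_mul] using this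
  have hpos : 0 < c₁ * ((P + R) * (Q + S) * conj Tot).im + c₂ * ((P + S) * (Q + R) * conj Tot).im +
      c₃ * ((P + Q) * (R + S) * conj Tot).im := by
    by_cases hc : 0 < c₁
    · nlinarith [mul_pos hc x₁, mul_nonneg h₂ x₂.le, mul_nonneg h₃ x₃.le]
    by_cases hc' : 0 < c₂
    · nlinarith [mul_pos hc' x₂, mul_nonneg h₁ x₁.le, mul_nonneg h₃ x₃.le]
    have hc₃ : 0 < c₃ := by
      push Not at hc hc'
      linarith
    nlinarith [mul_pos hc₃ x₃, mul_nonneg h₁ x₁.le, mul_nonneg h₂ x₂.le]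
  linarith

/-! ### 2. Vocabulary: swap and Brauer contraction on a bond (existing declarations only) -/

/-- Dirac's exchange operator `T_b = 2 𝐒_x·𝐒_y + ½` — for `x ≠ y` the swap of the two spins-½. -/
def swapOp {Λ : Type} [Fintype Λ] [DecidableEq Λ] (x y : Λ) : Op Λ 2 :=
  (2 : ℂ) • spinDot 1 x y + (1 / 2 : ℂ) • 1

/-- The Brauer contraction `Q_b = 2(S¹S¹ + S²S² − S³S³)_{xy} + ½ = 2|↑↓+↓↑⟩⟨↑↓+↓↑|` (for `x ≠ y`). -/
def contractOp {Λ : Type} [Fintype Λ] [DecidableEq Λ] (x y : Λ) : Op Λ 2 :=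
  (2 : ℂ) • (spinBond 1 0 x y + spinBond 1 1 x y - spinBond 1 2 x y) + (1 / 2 : ℂ) • 1

/-- The crux's bond operator `S¹_xS¹_y + S²_xS²_y + Δ S³_xS³_y` (so that `xxzHamiltonian 1 G (-1) Δ`
is minus its sum over edges). -/
def xxzBond {Λ : Type} [Fintype Λ] [DecidableEq Λ] (Δ : ℝ) (x y : Λ) : Op Λ 2 :=
  spinBond 1 0 x y + spinBond 1 1 x y + (Δ : ℂ) • spinBond 1 2 x y

/-- The occupation polynomial `Σ_S φ(1_S) z^S` is zero-free on `H^Λ` (the crux's inline predicate). -/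
def OccStable {Λ : Type} [Fintype Λ] [DecidableEq Λ] (φ : TensorIndex Λ 2 → ℂ) : Prop :=
  ∀ z : Λ → ℂ, (∀ i, 0 < (z i).im) →
    (∑ S : Finset Λ, φ (fun i => if i ∈ S then 0 else 1) * ∏ i ∈ S, z i) ≠ 0

/-! ### 3. The bond algebra and the cone (statements) -/

/-- **The 3-dimensional commutative bond algebra.** For `x ≠ y`: `T² = 1`, `TQ = QT = Q`, `Q² = 2Q`.
(Spin-½ bookkeeping on the 4-dimensional bond space; `T` fixes the symmetric state `|↑↓+↓↑⟩`.) -/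
def BrauerBondAlgebra : Prop :=
  ∀ (Λ : Type) [Fintype Λ] [DecidableEq Λ] (x y : Λ), x ≠ y →
    swapOp x y * swapOp x y = 1 ∧ swapOp x y * contractOp x y = contractOp x y ∧
    contractOp x y * swapOp x y = contractOp x y ∧
    contractOp x y * contractOp x y = (2 : ℂ) • contractOp x y

/-- **The window is the positive cone.** `(S¹S¹+S²S²+ΔS³S³)_b = ((1+Δ)/4)·T_b + ((1−Δ)/4)·Q_b − ¼`
for every real `Δ` (so the coefficients are both `≥ 0` iff `|Δ| ≤ 1`). -/
def BondInBrauerCone : Prop :=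
  ∀ (Λ : Type) [Fintype Λ] [DecidableEq Λ] (x y : Λ), x ≠ y → ∀ Δ : ℝ,
    xxzBond Δ x y = (((1 + Δ) / 4 : ℝ) : ℂ) • swapOp x y + (((1 - Δ) / 4 : ℝ) : ℂ) • contractOp x y
      - (1 / 4 : ℂ) • 1

/-- **Closed form of the bond Gibbs factor** (from the two previous statements, no Trotter, no Euler
limit): with `α = (1+Δ)/4`, `β = (1−Δ)/4`,
`exp(t·(S¹S¹+S²S²+ΔS³S³)_b) = e^{-t/4}·(cosh(αt)·1 + sinh(αt)·T_b + (e^{αt}(e^{2βt}−1)/2)·Q_b)`;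
all three coefficients are `≥ 0` for `t ≥ 0` iff `|Δ| ≤ 1`. -/
def BondExpClosedForm : Prop :=
  ∀ (Λ : Type) [Fintype Λ] [DecidableEq Λ] (x y : Λ), x ≠ y → ∀ Δ t : ℝ,
    NormedSpace.exp ((t : ℂ) • xxzBond Δ x y) =
      ((Real.exp (-t / 4) : ℝ) : ℂ) •
        (((Real.cosh ((1 + Δ) / 4 * t) : ℝ) : ℂ) • (1 : Op Λ 2) +
          ((Real.sinh ((1 + Δ) / 4 * t) : ℝ) : ℂ) • swapOp x y +
          ((Real.exp ((1 + Δ) / 4 * t) * (Real.exp (2 * ((1 - Δ) / 4) * t) - 1) / 2 : ℝ) : ℂ) •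
            contractOp x y)

/-- **Symbol of a cone element = weighted perfect matchings of K₄.** For `W = c₁·1 + c₂·T_b + c₃·Q_b`
the Borcea–Brändén symbol `Σ_S (Σ_{S'} W(1_{S'},1_S) z^{S'}) w^{Sᶜ}` equals
`[c₁(z_x+w_x)(z_y+w_y) + c₂(z_x+w_y)(z_y+w_x) + c₃(z_x+z_y)(w_x+w_y)] · ∏_{i∉{x,y}} (z_i+w_i)`. -/
def K4SymbolOfCone : Prop :=
  ∀ (Λ : Type) [Fintype Λ] [DecidableEq Λ] (x y : Λ), x ≠ y → ∀ (c₁ c₂ c₃ : ℝ) (z w : Λ → ℂ),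
    (∑ S : Finset Λ, (∑ S' : Finset Λ,
        ((c₁ : ℂ) • (1 : Op Λ 2) + (c₂ : ℂ) • swapOp x y + (c₃ : ℂ) • contractOp x y)
          (fun i => if i ∈ S' then 0 else 1) (fun i => if i ∈ S then 0 else 1) * ∏ i ∈ S', z i) *
        ∏ i ∈ Sᶜ, w i) =
      ((c₁ : ℂ) * ((z x + w x) * (z y + w y)) + (c₂ : ℂ) * ((z x + w y) * (z y + w x)) +
          (c₃ : ℂ) * ((z x + z y) * (w x + w y))) *
        ∏ i ∈ (Finset.univ.erase x).erase y, (z i + w i)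

/-- **FIRST LEMMA of the line — every element of the Brauer cone is a stability preserver.**
For `x ≠ y` and `c₁, c₂, c₃ ≥ 0`, `W = c₁·1 + c₂·T_b + c₃·Q_b` maps a vector with `H^Λ`-stable
occupation polynomial to one that is stable or to `0`.  Proof: `K4SymbolOfCone` + `k4Matchings_ne_zero`
(+ trivial case `c = 0`) give hypothesis `hK` of `multiAffine_kernel_stable_or_zero`. -/
def BrauerConePreserves : Prop :=
  ∀ (Λ : Type) [Fintype Λ] [DecidableEq Λ] (x y : Λ), x ≠ y → ∀ c₁ c₂ c₃ : ℝ, 0 ≤ c₁ → 0 ≤ c₂ → 0 ≤ c₃ →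
    ∀ φ : TensorIndex Λ 2 → ℂ, OccStable φ →
      ((c₁ : ℂ) • (1 : Op Λ 2) + (c₂ : ℂ) • swapOp x y + (c₃ : ℂ) • contractOp x y) *ᵥ φ = 0 ∨
        OccStable (((c₁ : ℂ) • (1 : Op Λ 2) + (c₂ : ℂ) • swapOp x y + (c₃ : ℂ) • contractOp x y) *ᵥ φ)

/-- **The cone lemma contains stubs A and B(i) of the picked line** (`stable-cone-variational-selection`):
the Euler gate `1 + ε·(S¹S¹+S²S²+ΔS³S³)_b = (1−ε/4)·1 + (ε(1+Δ)/4)·T_b + (ε(1−Δ)/4)·Q_b`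
(`0 ≤ ε ≤ 1`, `|Δ| ≤ 1`) and the bond Gibbs factor (`BondExpClosedForm`, `t ≥ 0`, `|Δ| ≤ 1`) are cone
elements; `exp` is invertible, so the zero alternative is excluded for it.  The two conjuncts below are
the skeleton's `stub_eulerGate` and the first conjunct of `stub_localFactors`, verbatim. -/
def ConeGivesGateAndBondSemigroup : Prop :=
  BrauerConePreserves → BondInBrauerCone → BondExpClosedForm →
    (∀ (Λ : Type) [Fintype Λ] [DecidableEq Λ] (x y : Λ), x ≠ y → ∀ (Δ ε : ℝ), |Δ| ≤ 1 → 0 ≤ ε → ε ≤ 1 →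
      ∀ φ : TensorIndex Λ 2 → ℂ,
        (∀ z : Λ → ℂ, (∀ i, 0 < (z i).im) →
          (∑ S : Finset Λ, φ (fun i => if i ∈ S then 0 else 1) * ∏ i ∈ S, z i) ≠ 0) →
        ((1 + (ε : ℂ) • (spinBond 1 0 x y + spinBond 1 1 x y + (Δ : ℂ) • spinBond 1 2 x y)) *ᵥ φ = 0 ∨
          (∀ z : Λ → ℂ, (∀ i, 0 < (z i).im) →
          (∑ S : Finset Λ, ((1 + (ε : ℂ) • (spinBond 1 0 x y + spinBond 1 1 x y + (Δ : ℂ) • spinBond 1 2 x y)) *ᵥ φ) (fun i => if i ∈ S then 0 else 1) * ∏ i ∈ S, z i) ≠ 0))) ∧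
    (∀ (Λ : Type) [Fintype Λ] [DecidableEq Λ] (x y : Λ), x ≠ y → ∀ (Δ t : ℝ), |Δ| ≤ 1 → 0 ≤ t →
      ∀ φ : TensorIndex Λ 2 → ℂ,
        (∀ z : Λ → ℂ, (∀ i, 0 < (z i).im) →
          (∑ S : Finset Λ, φ (fun i => if i ∈ S then 0 else 1) * ∏ i ∈ S, z i) ≠ 0) →
        (∀ z : Λ → ℂ, (∀ i, 0 < (z i).im) →
          (∑ S : Finset Λ, (NormedSpace.exp ((t : ℂ) • (spinBond 1 0 x y + spinBond 1 1 x y + (Δ : ℂ) • spinBond 1 2 x y)) *ᵥ φ) (fun i => if i ∈ S then 0 else 1) * ∏ i ∈ S, z i) ≠ 0))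

/-! ### 4. A corollary with teeth (falsifier, not used by the line): adjacent sectors interlace -/

/-- **Sector interlacing (prediction).**  For a connected graph, `|Δ| ≤ 1`, any real field and two
entrywise-nonnegative ground vectors `ψ` (sector `M`) and `ψ'` (sector `M − 1`, one particle fewer),
the `(|Λ|+1)`-variable polynomial `Σ_S ψ(1_S) z^S + w · Σ_S ψ'(1_S) z^S` is zero-free on `H^{Λ} × H`
(the two ground states are in Borcea–Brändén proper position).  It follows from the bond-disordered
form of the crux via a weakly coupled pendant "ghost" site; numerically it is a SHARPER detector of the
window than the crux itself (exp4: 0/130 violations inside `|Δ| ≤ 1`, 34/104 at `|Δ| ∈ {1.3,1.6}`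
where the per-sector test fails only 12/104). -/
def SectorInterlacing : Prop :=
  ∀ (Λ : Type) [Fintype Λ] [DecidableEq Λ] (G : SimpleGraph Λ) [DecidableRel G.Adj], G.Connected →
    ∀ (Δ : ℝ) (μ : Λ → ℝ), |Δ| ≤ 1 → ∀ (M : ℝ) (ψ ψ' : TensorIndex Λ 2 → ℂ),
      ψ ∈ spinZSector 1 M → ψ ≠ 0 → (∀ σ, 0 ≤ (ψ σ).re ∧ (ψ σ).im = 0) →
      (xxzHamiltonian 1 G (-1) Δ + ∑ x : Λ, ((μ x : ℝ) : ℂ) • siteSpin 1 x 2).mulVec ψ =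
        ((lowestEnergyInSector 1 (xxzHamiltonian 1 G (-1) Δ + ∑ x : Λ, ((μ x : ℝ) : ℂ) • siteSpin 1 x 2) M : ℝ) : ℂ) • ψ →
      ψ' ∈ spinZSector 1 (M - 1) → ψ' ≠ 0 → (∀ σ, 0 ≤ (ψ' σ).re ∧ (ψ' σ).im = 0) →
      (xxzHamiltonian 1 G (-1) Δ + ∑ x : Λ, ((μ x : ℝ) : ℂ) • siteSpin 1 x 2).mulVec ψ' =
        ((lowestEnergyInSector 1 (xxzHamiltonian 1 G (-1) Δ + ∑ x : Λ, ((μ x : ℝ) : ℂ) • siteSpin 1 x 2) (M - 1) : ℝ) : ℂ) • ψ' →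
      ∀ (z : Λ → ℂ) (w : ℂ), (∀ x, 0 < (z x).im) → 0 < w.im →
        (∑ S : Finset Λ, ψ (fun x => if x ∈ S then 0 else 1) * ∏ x ∈ S, z x) +
          w * (∑ S : Finset Λ, ψ' (fun x => if x ∈ S then 0 else 1) * ∏ x ∈ S, z x) ≠ 0

/-! ### 4b. The Euler gate IS a cone action, pointwise (proved from the disprover's API) -/

section GateInCone
open Matrix Complex

/-! The next three declarations are reproduced VERBATIM from the disprover's
`Cruxes/GroundStateStability/Disproof.lean` (section `Tightness`, refuter-cdisprove-…-9672-0, 2026-08-16),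
so that this sketch elaborates on farm snapshots that predate that commit; credit: that seat. -/

/-- Two single-site operators at distinct sites act on two coordinates. [Disproof.lean, verbatim] -/
theorem onSite_mul_onSite_mulVec_apply {Λ : Type} [Fintype Λ] [DecidableEq Λ] {q : ℕ} {x y : Λ}
    (hxy : x ≠ y) (a b : Matrix (Fin q) (Fin q) ℂ) (φ : TensorIndex Λ q → ℂ) (σ : TensorIndex Λ q) :
    ((onSite x a * onSite y b : Op Λ q) *ᵥ φ) σ =
      ∑ l, ∑ m, a (σ x) l * b (σ y) m * φ (Function.update (Function.update σ x l) y m) := by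
  rw [← Matrix.mulVec_mulVec, LiebMattis.onSite_mulVec_apply]
  refine Finset.sum_congr rfl fun l _ => ?_
  rw [LiebMattis.onSite_mulVec_apply, Function.update_of_ne hxy.symm, Finset.mul_sum]
  refine Finset.sum_congr rfl fun m _ => ?_
  ring

/-- Swap the values of a configuration at two sites. [Disproof.lean, verbatim] -/
def swapAt {Λ : Type} [DecidableEq Λ] (x y : Λ) (σ : TensorIndex Λ 2) : TensorIndex Λ 2 :=
  Function.update (Function.update σ x (σ y)) y (σ x)

/-- Action of the spin-½ XXZ bond in the occupation basis. [Disproof.lean `xxzBond_mulVec_apply`, verbatim] -/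
theorem xxzBond_mulVec_apply {Λ : Type} [Fintype Λ] [DecidableEq Λ] {x y : Λ} (hxy : x ≠ y) (Δ : ℂ)
    (φ : TensorIndex Λ 2 → ℂ) (σ : TensorIndex Λ 2) :
    ((spinBond 1 0 x y + spinBond 1 1 x y + Δ • spinBond 1 2 x y) *ᵥ φ) σ =
      Δ * (if σ x = σ y then (1 / 4 : ℂ) else -(1 / 4 : ℂ)) * φ σ +
        (if σ x = σ y then 0 else (1 / 2 : ℂ) * φ (swapAt x y σ)) := by
  have key : ∀ i : Fin 2, i = 0 ∨ i = 1 := by decide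
  have hcomm : ∀ (l m : Fin 2), Function.update (Function.update σ y m) x l =
      Function.update (Function.update σ x l) y m := fun l m => Function.update_comm hxy.symm _ _ _
  simp only [spinBond, siteSpin, spinVec_one_eq_half_spinHalfPauli, Matrix.add_mulVec,
    Matrix.smul_mulVec, Pi.add_apply, Pi.smul_apply, smul_eq_mul,
    onSite_mul_onSite_mulVec_apply hxy, onSite_mul_onSite_mulVec_apply hxy.symm, hcomm,
    Matrix.smul_apply, swapAt]
  have h1 : Function.update (Function.update σ x (σ x)) y (σ y) = σ := by
    simp only [Function.update_eq_self]
  rcases key (σ x) with hx | hx <;> rcases key (σ y) with hy | hy <;> rw [hx, hy] at h1 <;>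
    simp [hx, hy, spinHalfPauli, h1] <;> ring_nf <;> simp [Complex.I_sq] <;> ring


theorem swapAt_eq_self_of_eq {Λ : Type} [DecidableEq Λ] {x y : Λ} (σ : TensorIndex Λ 2)
    (h : σ x = σ y) : swapAt x y σ = σ := by
  funext z
  unfold swapAt
  rcases eq_or_ne z y with rfl | hzy
  · simp [h]
  · rw [Function.update_of_ne hzy]
    rcases eq_or_ne z x with rfl | hzx
    · simp [h]
    · rw [Function.update_of_ne hzx]

/-- **Gate = cone action (kernel-checked).** For `x ≠ y` the Euler gate `1 + ε(S¹S¹+S²S²+ΔS³S³)_{xy}`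
acts on occupation amplitudes as `(1 − ε/4)·id + (ε(1+Δ)/4)·swap + (ε(1−Δ)/4)·contraction`, where
`swap φ (σ) = φ(σ^{xy})` and `contraction φ (σ) = [σ_x ≠ σ_y](φ(σ) + φ(σ^{xy}))` — i.e. the gate is the
cone element with coordinates `(1−ε/4, εα, εβ)`, all `≥ 0` for `0 ≤ ε ≤ 4`, `|Δ| ≤ 1`. -/
theorem gate_apply_eq_cone {Λ : Type} [Fintype Λ] [DecidableEq Λ] {x y : Λ} (hxy : x ≠ y) (Δ ε : ℝ)
    (φ : TensorIndex Λ 2 → ℂ) (σ : TensorIndex Λ 2) :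
    ((1 + (ε : ℂ) • (spinBond 1 0 x y + spinBond 1 1 x y + (Δ : ℂ) • spinBond 1 2 x y)) *ᵥ φ) σ =
      ((1 - ε / 4 : ℝ) : ℂ) * φ σ + ((ε * (1 + Δ) / 4 : ℝ) : ℂ) * φ (swapAt x y σ) +
        ((ε * (1 - Δ) / 4 : ℝ) : ℂ) * (if σ x = σ y then 0 else φ σ + φ (swapAt x y σ)) := by
  rw [Matrix.add_mulVec, Matrix.one_mulVec, Matrix.smul_mulVec, Pi.add_apply, Pi.smul_apply,
    xxzBond_mulVec_apply hxy, smul_eq_mul]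
  by_cases h : σ x = σ y
  · rw [swapAt_eq_self_of_eq σ h]
    simp only [h, if_true]
    push_cast
    ring
  · simp only [h, if_false]
    push_cast
    ring

end GateInCone

/-! ### 5. How the line concludes the crux (statement only; the composition is the picked skeleton's) -/

/-- The crux, by name, for reference in the card. -/
example : Prop := Summit.AtomisticToContinuum.BoseEinsteinCondensation.Theses.BECStronglyRayleigh.GroundStateStability

end

end Summit.AtomisticToContinuum.BoseEinsteinCondensation.Cruxes.GroundStateStability.SketchK2
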